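import Summits.BirchSwinnertonDyer.BirchSwinnertonDyer.Theorems.ManinLocalTwoThreeAdditiveTwoJBound
import Literature.NumberTheory.EllipticCurves.NeronComponentIndexTypeIIIstarProofs
import HarnessLib

/-!
# an's S-an-47 `PotOrdinaryAdditiveShapeTwo` as a theorem: a potentially ORDINARY additive fibre at `2` is `I₄*` with `(f₂, ord₂Δ_min) = (4, 12)`
# or `I₈*` with `(6, 18)`; the types `III*`, `II*` (and `II, III, IV, I₀*, IV*`) at `2` are potentially supersingular

Summit `BirchSwinnertonDyer`, route `ManinLocalTwoThree` (cell bsd-f2-manin), cruxes C2 `ManinOddAtFour` (stmt-BirchSwinnertonDyer-22967) and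
C3 (stmt-…-22968).  an g25's support row S-an-47 (MEMO-an §67.11, Sketch-an-g25b :39; census 26 573 + 13 720 / 40 293; mechanism in the memo:
Serre–Tate, `e = 2`, ramified quadratic twist of a good ordinary curve) — here from Tate's algorithm over `ℤ₂` literally:

* §1 (DVR, `2` a uniformiser): on the Step-9 model (`III*`: `a₁ = 2α`, `a₂ = 4p`, `a₃ = 8γ`, `a₄ = 8q`, `q ∈ Rˣ`, `a₆ = 32r`)
  `c₄ = 16((α² + 4p)² − 24(αγ + q))`: `α ∈ Rˣ ⟹ (ord c₄, ord Δ) = (4, 10)`, `2 ∣ α ⟹ 2⁷ ∣ c₄` (and `ord Δ ∈ {12, 14, 15}`); on the Step-10 model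
  (`II*`: `a₄ = 16q`, `a₆ = 32r`, `r ∈ Rˣ`): `α ∈ Rˣ ⟹ (4, 11)`, `2 ∣ α ⟹ 2⁸ ∣ c₄` (`ord Δ ∈ {12, 14}`); and `IV* ⟹ ord Δ = 8`
  (`addVal_c₄_Δ_of_kodairaSymbolOfMinimal_eq_IIIstar/IIstar`, `addVal_Δ_toNat_eq_eight_of_kodairaSymbolOfMinimal_eq_IVstar`).
* §2 over `ℚ`: `potSupersingular_of_kodairaSymbolAt_IIIstar_two` (`ord₂ j ∈ {2} ∪ [6, ∞)`), `potSupersingular_of_kodairaSymbolAt_IIstar_two`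
  (`ord₂ j ≥ 1`), `ordMinimalDiscriminant_eq_eight_of_kodairaSymbolAt_IVstar_two`; and **`potOrdinaryAdditiveShapeTwo`** (S-an-47 BY VALUE):
  `4 ∣ N`, `j ≠ 0`, `ord₂ j = 0` ⟹ `(ord₂ N, ord₂ Δ_min) ∈ {(4, 12), (6, 18)}` — by the type cases: `II, III, IV, I₀*, IV*` have `ord₂Δ_min ≤ 10 < 12`
  (`…AdditiveTwoJBound`), `III*`, `II*` are potentially supersingular (§2), `Iₙ*` is `…IstarTwoJValuation`'s
  `eq_four_or_eq_eight_of_kodairaSymbolAt_Istar_two_of_padicValRat_j_eq_zero`.  With `…TwoHauptmodul`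
  (`ord₂ j = 0 ⟺ K ∈ {0, 12}` on the potentially good locus) this completes E-an-121's dictionary at `2` in valuation form.

HONEST FRAMING: local structure theorems (classification facts: Kraus 1990 / Papadopoulos 1993 Table IV); C2, C3, Manin's conjecture and BSD are not
proved.  No definitions, no named facts, no sorry.  References: [SilvermanATAEC1994] IV.9.4 Steps 8–10, Table 4.1; [Kraus1990]; [Papadopoulos1993] Table IV.
-/

set_option linter.dupNamespace false
set_option autoImplicit false

noncomputable section

open scoped Classical

open WeierstrassCurve IsDedekindDomain IsLocalRing Polynomial
  Literature.NumberTheory.DiophantineGeometry Literature.NumberTheory.DiophantineGeometry.TateAlgorithm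
  Literature.NumberTheory.DiophantineGeometry.TateAlgorithm.CharTwo
  Literature.NumberTheory.EllipticCurves Literature.NumberTheory.EllipticCurves.LocalIndex
open IsDiscreteValuationRing hiding maximalIdeal

namespace Summit.BirchSwinnertonDyer.BirchSwinnertonDyer.Theorems.ManinLocalTwoThree

/-! ### §1 Local: `c₄` and `Δ` on the Step-9 / Step-10 models, `2` a uniformiser -/

section DVR

variable {R : Type*} [CommRing R] [IsDomain R] [IsDiscreteValuationRing R]

omit [IsDomain R] [IsDiscreteValuationRing R] in
/-- Divisibility of `c₄` is unchanged by any change of variables over `R` (`c₄ ↦ u⁻⁴c₄`, `u ∈ Rˣ`). [folklore] -/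
theorem dvd_c₄_smul_iff (D : WeierstrassCurve.VariableChange R) (W : WeierstrassCurve R) (d : R) :
    d ∣ (D • W).c₄ ↔ d ∣ W.c₄ := by
  rw [WeierstrassCurve.variableChange_c₄]; exact ((Units.isUnit D.u⁻¹).pow 4).dvd_mul_left

/-- `ord c₄` is unchanged by any change of variables over `R`. [folklore] -/
theorem addVal_c₄_smul_toNat (D : WeierstrassCurve.VariableChange R) (W : WeierstrassCurve R) :
    (addVal R (D • W).c₄).toNat = (addVal R W.c₄).toNat := by
  rw [WeierstrassCurve.variableChange_c₄, IsDiscreteValuationRing.addVal_mul,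
    IsDiscreteValuationRing.addVal_eq_zero_iff.mpr ((Units.isUnit D.u⁻¹).pow 4), zero_add]

/-- **Type `III*`, `2` a uniformiser: `(ord c₄, ord Δ) = (4, 10)`, or `2⁷ ∣ c₄` with `ord Δ ∈ {12, 14, 15}`.**
[cite: SilvermanATAEC1994, IV.9.4 Step 9 and Table 4.1] -/
theorem addVal_c₄_Δ_of_kodairaSymbolOfMinimal_eq_IIIstar [PerfectField (ResidueField R)] (h2 : Irreducible (2 : R))
    (V : WeierstrassCurve R) (hV : V.kodairaSymbolOfMinimal = .IIIstar) :
    ((addVal R V.c₄).toNat = 4 ∧ (addVal R V.Δ).toNat = 10) ∨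
      ((2 : R) ^ 7 ∣ V.c₄ ∧ ((addVal R V.Δ).toNat = 12 ∨ (addVal R V.Δ).toNat = 14 ∨ (addVal R V.Δ).toNat = 15)) := by
  obtain ⟨D, h₁, h₂, h₃, h₄, h₄', h₆⟩ := exists_smul_of_kodairaSymbolOfMinimal_eq_IIIstar V hV
  have hm : ∀ {x : R}, x ∈ maximalIdeal R ↔ (2 : R) ∣ x := fun {x} ↦ mem_maximalIdeal_iff_dvd_of_irreducible h2 x
  have hmn : ∀ {x : R} {n : ℕ}, x ∈ maximalIdeal R ^ n ↔ (2 : R) ^ n ∣ x := fun {x n} ↦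
    mem_maximalIdeal_pow_iff_dvd_of_irreducible h2 x n
  obtain ⟨α, hα⟩ := hm.mp h₁
  obtain ⟨p, hp⟩ := hmn.mp h₂
  obtain ⟨γ, hγ⟩ := hmn.mp h₃
  obtain ⟨q, hq⟩ := hmn.mp h₄
  obtain ⟨r, hr⟩ := hmn.mp h₆
  have hqu : IsUnit q := by
    rw [isUnit_iff_not_dvd h2]; rintro ⟨q', hq'⟩; exact h₄' (hmn.mpr ⟨q', by rw [hq, hq']; ring⟩)
  have hstep := addVal_Δ_toNat_of_step9 h2 (D • V) hα hp hγ hq hr hqu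
  rw [← addVal_Δ_smul_toNat D V, ← addVal_c₄_smul_toNat D V, ← dvd_c₄_smul_iff D V]
  by_cases hαu : IsUnit α
  · left
    refine ⟨?_, hstep.1 hαu⟩
    have e : (D • V).c₄ = 2 ^ 4 * (α ^ 4 + 2 * (4 * α ^ 2 * p + 8 * p ^ 2 - 12 * α * γ - 12 * q)) := by
      simp only [WeierstrassCurve.c₄, WeierstrassCurve.b₂, WeierstrassCurve.b₄, hα, hp, hγ, hq]; ring
    exact addVal_toNat_eq_of_two h2 (hαu.pow 4) e
  · right
    obtain ⟨α₁, hα₁⟩ := (not_isUnit_iff_dvd h2 _).mp hαu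
    refine ⟨⟨2 * (α₁ ^ 2 + p) ^ 2 - 6 * α₁ * γ - 3 * q, ?_⟩, ?_⟩
    · simp only [WeierstrassCurve.c₄, WeierstrassCurve.b₂, WeierstrassCurve.b₄, hα, hp, hγ, hq, hα₁]; ring
    · by_cases hγu : IsUnit γ
      · exact Or.inl (hstep.2.1 α₁ hα₁ hγu)
      · obtain ⟨γ₁, hγ₁⟩ := (not_isUnit_iff_dvd h2 _).mp hγu
        by_cases hT : IsUnit (r + (α₁ ^ 2 + p) * q)
        · exact Or.inr (Or.inl (hstep.2.2.1 α₁ γ₁ hα₁ hγ₁ hT))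
        · exact Or.inr (Or.inr (hstep.2.2.2 α₁ γ₁ hα₁ hγ₁ hT))

/-- **Type `II*`, `2` a uniformiser: `(ord c₄, ord Δ) = (4, 11)`, or `2⁸ ∣ c₄` with `ord Δ ∈ {12, 14}`.**
[cite: SilvermanATAEC1994, IV.9.4 Step 10 and Table 4.1] -/
theorem addVal_c₄_Δ_of_kodairaSymbolOfMinimal_eq_IIstar [PerfectField (ResidueField R)] (h2 : Irreducible (2 : R))
    (V : WeierstrassCurve R) (hV : V.kodairaSymbolOfMinimal = .IIstar) :
    ((addVal R V.c₄).toNat = 4 ∧ (addVal R V.Δ).toNat = 11) ∨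
      ((2 : R) ^ 8 ∣ V.c₄ ∧ ((addVal R V.Δ).toNat = 12 ∨ (addVal R V.Δ).toNat = 14)) := by
  obtain ⟨D, h₁, h₂, h₃, h₄, h₆, h₆'⟩ := exists_smul_of_kodairaSymbolOfMinimal_eq_IIstar V hV
  have hm : ∀ {x : R}, x ∈ maximalIdeal R ↔ (2 : R) ∣ x := fun {x} ↦ mem_maximalIdeal_iff_dvd_of_irreducible h2 x
  have hmn : ∀ {x : R} {n : ℕ}, x ∈ maximalIdeal R ^ n ↔ (2 : R) ^ n ∣ x := fun {x n} ↦
    mem_maximalIdeal_pow_iff_dvd_of_irreducible h2 x n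
  obtain ⟨α, hα⟩ := hm.mp h₁
  obtain ⟨p, hp⟩ := hmn.mp h₂
  obtain ⟨γ, hγ⟩ := hmn.mp h₃
  obtain ⟨q, hq⟩ := hmn.mp h₄
  obtain ⟨r, hr⟩ := hmn.mp h₆
  have hru : IsUnit r := by
    rw [isUnit_iff_not_dvd h2]; rintro ⟨r', hr'⟩; exact h₆' (hmn.mpr ⟨r', by rw [hr, hr']; ring⟩)
  have hstep := addVal_Δ_toNat_of_step10 h2 (D • V) hα hp hγ hq hr hru
  rw [← addVal_Δ_smul_toNat D V, ← addVal_c₄_smul_toNat D V, ← dvd_c₄_smul_iff D V]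
  by_cases hαu : IsUnit α
  · left
    refine ⟨?_, hstep.1 hαu⟩
    have e : (D • V).c₄ = 2 ^ 4 * (α ^ 4 + 2 * (4 * α ^ 2 * p + 8 * p ^ 2 - 12 * α * γ - 24 * q)) := by
      simp only [WeierstrassCurve.c₄, WeierstrassCurve.b₂, WeierstrassCurve.b₄, hα, hp, hγ, hq]; ring
    exact addVal_toNat_eq_of_two h2 (hαu.pow 4) e
  · right
    obtain ⟨α₁, hα₁⟩ := (not_isUnit_iff_dvd h2 _).mp hαu
    refine ⟨⟨(α₁ ^ 2 + p) ^ 2 - 3 * (α₁ * γ + q), ?_⟩, ?_⟩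
    · simp only [WeierstrassCurve.c₄, WeierstrassCurve.b₂, WeierstrassCurve.b₄, hα, hp, hγ, hq, hα₁]; ring
    · by_cases hγu : IsUnit γ
      · exact Or.inl (hstep.2.1 α₁ hα₁ hγu)
      · obtain ⟨γ₁, hγ₁⟩ := (not_isUnit_iff_dvd h2 _).mp hγu
        exact Or.inr (hstep.2.2 α₁ γ₁ hα₁ hγ₁)

/-- **Type `IV*`, `2` a uniformiser: `ord Δ = 8`.** [cite: SilvermanATAEC1994, IV.9.4 Step 8 and Table 4.1] -/
theorem addVal_Δ_toNat_eq_eight_of_kodairaSymbolOfMinimal_eq_IVstar [PerfectField (ResidueField R)] (h2 : Irreducible (2 : R))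
    (V : WeierstrassCurve R) (hV : V.kodairaSymbolOfMinimal = .IVstar) : (addVal R V.Δ).toNat = 8 := by
  obtain ⟨D, h₁, h₂, h₃, h₄, h₆, h8⟩ := exists_smul_of_kodairaSymbolOfMinimal_eq_IVstar V hV
  have hm : ∀ {x : R}, x ∈ maximalIdeal R ↔ (2 : R) ∣ x := fun {x} ↦ mem_maximalIdeal_iff_dvd_of_irreducible h2 x
  have hmn : ∀ {x : R} {n : ℕ}, x ∈ maximalIdeal R ^ n ↔ (2 : R) ^ n ∣ x := fun {x n} ↦
    mem_maximalIdeal_pow_iff_dvd_of_irreducible h2 x n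
  obtain ⟨γ, hγ⟩ := hmn.mp h₃
  obtain ⟨r, hr⟩ := hmn.mp h₆
  have hγu := isUnit_of_distinctRootCount_quadraticStep8_eq_two h2 hγ hr h8
  rw [← addVal_Δ_smul_toNat D V]
  exact addVal_Δ_toNat_eq_eight_of_step8 h2 (D • V) (hm.mp h₁) (hmn.mp h₂) hγ hγu (hmn.mp h₄) (hmn.mp h₆)

end DVR

/-! ### §2 Over `ℚ` at `2` -/

section Rat

open NumberField Rat.HeightOneSpectrum Summit.BirchSwinnertonDyer.Rank1Residual.Additive

/-- `ord₂ j = 3k − ord₂ Δ_min` when `ord c₄(M) = k ≠ 0` on the local minimal model at `2`. [folklore] -/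
theorem padicValRat_two_j_eq_of_addVal_c₄ (W : WeierstrassCurve ℚ) [W.IsElliptic] {k : ℕ} (hk : k ≠ 0)
    (hc₄ : (addVal ((placeOf 2).adicCompletionIntegers ℚ) (W.localMinimalIntegralModel (placeOf 2)).c₄).toNat = k) :
    padicValRat 2 W.j = 3 * (k : ℤ) - W.ordMinimalDiscriminant (placeOf 2) := by
  have hval := valuation_j_eq_exp_of_addVal_c₄ (placeOf 2) W hk hc₄
  have hj0 : W.j ≠ 0 := by
    intro h0; rw [h0, map_zero] at hval; exact WithZero.exp_ne_zero hval.symm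
  have hgen : natGenerator (placeOf 2) = 2 := congrArg Subtype.val ((primesEquiv (R := ℤ)).apply_symm_apply ⟨2, Nat.prime_two⟩)
  rw [valuation_eq_exp_neg_padicValRat (placeOf 2) hj0, hgen] at hval
  have := WithZero.exp_injective hval
  linarith

/-- **Type `III*` at `2` is potentially supersingular:** `j = 0` or `ord₂ j ≥ 2` (`= 2` if `ord₂Δ_min = 10`, `≥ 6` otherwise).
[cite: SilvermanATAEC1994, IV.9.4 Step 9 and Table 4.1] -/
theorem potSupersingular_of_kodairaSymbolAt_IIIstar_two (W : WeierstrassCurve ℚ) [W.IsElliptic]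
    (hT : W.kodairaSymbolAt (placeOf 2) = .IIIstar) : W.j = 0 ∨ 2 ≤ padicValRat 2 W.j := by
  haveI : PerfectField (IsLocalRing.ResidueField ((placeOf 2).adicCompletionIntegers ℚ)) := PerfectField.ofFinite
  have h2 := irreducible_two_adicCompletionIntegers_placeOf_two
  rw [kodairaSymbolAt_def] at hT
  set M := W.localMinimalIntegralModel (placeOf 2) with hM
  have hδ : W.ordMinimalDiscriminant (placeOf 2) = (addVal ((placeOf 2).adicCompletionIntegers ℚ) M.Δ).toNat := rfl
  by_cases hj : W.j = 0
  · exact Or.inl hj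
  right
  have hc₄0 : M.c₄ ≠ 0 := localMinimalIntegralModel_c₄_ne_zero_of_j_ne_zero (placeOf 2) W hj
  rcases addVal_c₄_Δ_of_kodairaSymbolOfMinimal_eq_IIIstar h2 M hT with ⟨hc, hd⟩ | ⟨hdvd, hd⟩
  · have := padicValRat_two_j_eq_of_addVal_c₄ W (by norm_num) hc; rw [hδ, hd] at this; push_cast at this; linarith
  · have hk := le_addVal_toNat_of_pow_dvd h2 hc₄0 hdvd
    have := padicValRat_two_j_eq_of_addVal_c₄ W (k := (addVal ((placeOf 2).adicCompletionIntegers ℚ) M.c₄).toNat) (by omega) rfl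
    rw [hδ] at this
    have hk' : (7 : ℤ) ≤ (addVal ((placeOf 2).adicCompletionIntegers ℚ) M.c₄).toNat := by exact_mod_cast hk
    have hd' : ((addVal ((placeOf 2).adicCompletionIntegers ℚ) M.Δ).toNat : ℤ) ≤ 15 := by rcases hd with h | h | h <;> rw [h] <;> norm_num
    linarith

/-- **Type `II*` at `2` is potentially supersingular:** `j = 0` or `ord₂ j ≥ 1` (`= 1` if `ord₂Δ_min = 11`, `≥ 10` otherwise).
[cite: SilvermanATAEC1994, IV.9.4 Step 10 and Table 4.1] -/
theorem potSupersingular_of_kodairaSymbolAt_IIstar_two (W : WeierstrassCurve ℚ) [W.IsElliptic]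
    (hT : W.kodairaSymbolAt (placeOf 2) = .IIstar) : W.j = 0 ∨ 1 ≤ padicValRat 2 W.j := by
  haveI : PerfectField (IsLocalRing.ResidueField ((placeOf 2).adicCompletionIntegers ℚ)) := PerfectField.ofFinite
  have h2 := irreducible_two_adicCompletionIntegers_placeOf_two
  rw [kodairaSymbolAt_def] at hT
  set M := W.localMinimalIntegralModel (placeOf 2) with hM
  have hδ : W.ordMinimalDiscriminant (placeOf 2) = (addVal ((placeOf 2).adicCompletionIntegers ℚ) M.Δ).toNat := rfl
  by_cases hj : W.j = 0
  · exact Or.inl hj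
  right
  have hc₄0 : M.c₄ ≠ 0 := localMinimalIntegralModel_c₄_ne_zero_of_j_ne_zero (placeOf 2) W hj
  rcases addVal_c₄_Δ_of_kodairaSymbolOfMinimal_eq_IIstar h2 M hT with ⟨hc, hd⟩ | ⟨hdvd, hd⟩
  · have := padicValRat_two_j_eq_of_addVal_c₄ W (by norm_num) hc; rw [hδ, hd] at this; push_cast at this; linarith
  · have hk := le_addVal_toNat_of_pow_dvd h2 hc₄0 hdvd
    have := padicValRat_two_j_eq_of_addVal_c₄ W (k := (addVal ((placeOf 2).adicCompletionIntegers ℚ) M.c₄).toNat) (by omega) rfl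
    rw [hδ] at this
    have hk' : (8 : ℤ) ≤ (addVal ((placeOf 2).adicCompletionIntegers ℚ) M.c₄).toNat := by exact_mod_cast hk
    have hd' : ((addVal ((placeOf 2).adicCompletionIntegers ℚ) M.Δ).toNat : ℤ) ≤ 14 := by rcases hd with h | h <;> rw [h] <;> norm_num
    linarith

/-- **Type `IV*` at `2`: `ord₂ Δ_min = 8`.** [cite: SilvermanATAEC1994, IV.9.4 Step 8 and Table 4.1] -/
theorem ordMinimalDiscriminant_eq_eight_of_kodairaSymbolAt_IVstar_two (W : WeierstrassCurve ℚ) [W.IsElliptic]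
    (hT : W.kodairaSymbolAt (placeOf 2) = .IVstar) : W.ordMinimalDiscriminant (placeOf 2) = 8 := by
  haveI : PerfectField (IsLocalRing.ResidueField ((placeOf 2).adicCompletionIntegers ℚ)) := PerfectField.ofFinite
  rw [kodairaSymbolAt_def] at hT
  exact addVal_Δ_toNat_eq_eight_of_kodairaSymbolOfMinimal_eq_IVstar irreducible_two_adicCompletionIntegers_placeOf_two _ hT

/-- **S-an-47 `PotOrdinaryAdditiveShapeTwo` BY VALUE** (an g25, Sketch-an-g25b :39; in print: Serre 1972 §5.6 / Kraus 1990): an additive,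
potentially good, potentially ORDINARY fibre at `2` (`4 ∣ N`, `j ≠ 0`, `ord₂ j = 0`) has `(ord₂ N, ord₂ Δ_min) ∈ {(4, 12), (6, 18)}`
(types `I₄*`, `I₈*`). [cite: SilvermanATAEC1994, IV.9.4 Table 4.1 and IV.11.1] [cite: Kraus1990] -/
theorem potOrdinaryAdditiveShapeTwo (W : WeierstrassCurve ℚ) [W.IsElliptic] [W.IsGloballyMinimal]
    (h4 : 2 ^ 2 ∣ W.conductorNorm ℤ) (hj : W.j ≠ 0) (hv : padicValRat 2 W.j = 0) :
    (padicValNat 2 (W.conductorNorm ℤ) = 4 ∧ padicValInt 2 W.minimalDiscriminantInt = 12) ∨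
      (padicValNat 2 (W.conductorNorm ℤ) = 6 ∧ padicValInt 2 W.minimalDiscriminantInt = 18) := by
  haveI : PerfectField (IsLocalRing.ResidueField ((placeOf 2).adicCompletionIntegers ℚ)) := PerfectField.ofFinite
  have h2 := irreducible_two_adicCompletionIntegers_placeOf_two
  obtain ⟨-, hadd⟩ := oggComponents_eq_numComponents_of_sq_dvd W 2 h4
  have haddW : W.HasAdditiveReductionAt (placeOf 2) := (isAdditive_kodairaSymbolAt_iff_holds (placeOf 2) W).mp hadd
  have h12 := twelve_le_ordMinimalDiscriminant_of_potOrdinary_additive_two W haddW hj hv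
  have hδ : W.ordMinimalDiscriminant (placeOf 2) = padicValInt 2 W.minimalDiscriminantInt := ordMinimalDiscriminant_placeOf_eq W 2
  have hfac : (W.conductorNorm ℤ).factorization 2 = W.conductorExponent (placeOf 2) :=
    factorization_conductorNorm_primesEquiv_symm W ⟨2, Nat.prime_two⟩
  have hval : padicValNat 2 (W.conductorNorm ℤ) = W.conductorExponent (placeOf 2) := by rw [← hfac, Nat.factorization_def _ Nat.prime_two]
  have hδ' : W.ordMinimalDiscriminant (placeOf 2) = (addVal ((placeOf 2).adicCompletionIntegers ℚ) (W.localMinimalIntegralModel (placeOf 2)).Δ).toNat :=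
    rfl
  have hΔ0 := localMinimalIntegralModel_Δ_ne_zero (placeOf 2) W
  rcases eq_of_isAdditive hadd with h | h | h | ⟨N, hN⟩ | h | h | h
  · -- `II`: `ord₂ Δ_min ≤ 7`
    exfalso
    have hT := h; rw [kodairaSymbolAt_def] at hT
    rcases addVal_Δ_toNat_eq_of_kodairaSymbolOfMinimal_eq_II_of_two h2 _ hT with e | e | e <;> rw [hδ'] at h12 <;> omega
  · -- `III`: `≤ 9`
    exfalso
    have hT := h; rw [kodairaSymbolAt_def] at hT
    rcases addVal_Δ_toNat_eq_of_kodairaSymbolOfMinimal_eq_III_of_two h2 _ hT with e | e | e | e <;> rw [hδ'] at h12 <;> omega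
  · -- `IV`: `ord₂ Δ_min = f₂ + 2 ≤ 10`
    exfalso
    have hf8 : W.conductorExponent (placeOf 2) ≤ 8 := W.conductorExponent_le_eight_holds (placeOf 2)
    have hle : W.numComponentsAt (placeOf 2) ≤ W.ordMinimalDiscriminant (placeOf 2) + 1 := numComponentsAt_le_holds (placeOf 2) W
    unfold conductorExponent at hf8; unfold numComponentsAt at hf8 hle
    rw [h] at hf8 hle; simp [KodairaSymbol.numComponents] at hf8 hle; omega
  · -- `Iₙ*`: the two potentially ordinary rows
    rcases N with _ | n
    · exfalso
      have hT := hN; rw [kodairaSymbolAt_def] at hT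
      rcases addVal_Δ_toNat_eq_of_kodairaSymbolOfMinimal_eq_Istar_zero_of_two h2 _ hΔ0 hT with e | e | e <;> rw [hδ'] at h12 <;> omega
    · rcases eq_four_or_eq_eight_of_kodairaSymbolAt_Istar_two_of_padicValRat_j_eq_zero W hN (by omega) hv with
        ⟨-, hd, hf⟩ | ⟨-, hd, hf⟩
      · left; exact ⟨by rw [hval, hf], by rw [← hδ, hd]⟩
      · right; exact ⟨by rw [hval, hf], by rw [← hδ, hd]⟩
  · -- `IV*`: `ord₂ Δ_min = 8`
    exfalso
    have := ordMinimalDiscriminant_eq_eight_of_kodairaSymbolAt_IVstar_two W h; omega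
  · -- `III*`: potentially supersingular
    exfalso
    rcases potSupersingular_of_kodairaSymbolAt_IIIstar_two W h with h0 | h1
    · exact hj h0
    · linarith
  · -- `II*`: potentially supersingular
    exfalso
    rcases potSupersingular_of_kodairaSymbolAt_IIstar_two W h with h0 | h1
    · exact hj h0
    · linarith

end Rat

end Summit.BirchSwinnertonDyer.BirchSwinnertonDyer.Theorems.ManinLocalTwoThree

end
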